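import Literature.AlgebraicGeometry.Frobenioids.ArchimedeanRCConnected
import Literature.AlgebraicGeometry.Frobenioids.ArchimedeanFrobeniusTrivial
import Literature.AlgebraicGeometry.Frobenioids.ArchimedeanPullbacks
import Literature.AlgebraicGeometry.Frobenioids.FiberProductsMorphisms
import Literature.AlgebraicGeometry.Frobenioids.BaseFrobeniusSections
import Literature.AlgebraicGeometry.Frobenioids.ModelFrobenioidBaseSectionSkeleton
import HarnessLib

/-!
# Frobenioids II, Example 3.3 / Theorem 3.6 (i): the archimedean Frobenioid `C = C₀ ×_{D₀} D` is of
# PRE-MODEL type ([FrdI] Def. 2.7 (iii)) — the standard unit discs form a base-Frobenius pair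

Mochizuki, *The geometry of Frobenioids II: poly-Frobenioids*, Kyushu J. Math. **62** (2008)
401–460, §3, Theorem 3.6 (i), kurims text p. 36 ll. 34–35 [cite: MochizukiFrdII2008, Thm 3.6 (i) p.36]:
"The Frobenioid `(C^Λ)^istr` is of isotropic, base-trivial, and model type"; [FrdI] Def. 4.5 (i) p. 86:
"If `C` is of pre-model and birationally Frobenius-normalized type, then we shall say that `C` is of
*model type*"; [FrdI] Def. 2.7 (iii) p. 52: `C` is of *pre-model type* if it admits a base-Frobenius pair
`(P, F)` — `P ⊆ C^pl-bk` a skeleton of Frobenius-trivial objects mapping equivalently onto `D`, `F` a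
`P`-Frobenius-section [cite: MochizukiFrdI2008, Def. 2.7(iii) p.52].

PROOF-ONLY file (abc-iut cell, layer L1; row M13-c3 «Thm 3.6 (i) model type at `Λ = ℚ`», piece P1a of
the design HOME/staging/L1/L1-t6/g3/M13-c3-DESIGN.md; seat abc-iut-L1-t6 = typer of record of Ex. 3.3).
For the archimedean Frobenioid `C → F_Φ` of Example 3.3 (i) over ANY base `π : D → D₀` we exhibit the
base-Frobenius pair print uses implicitly throughout §3 (the "standard" isotropic objects):
* `stdPresection π` — the subcategory `P`: objects the STANDARD UNIT DISCS `C.std π d = (Spec π(d), unit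
  disc)` (`ArchimedeanRCConnected.lean`) over the chosen representatives `d` of the isomorphism classes of
  `D` (Mathlib's `Skeleton D`, as in `ModelFrobenioidBaseSectionSkeleton.lean`), arrows the linear arrows
  with scalar `1` between them (= the lifts `C.stdMap π u = ((π u, 1, 1), u)`);
* `stdFrobeniusSection π` — `F : ℕ_{≥1} → End(P ↪ C)`, `n ↦` the Frobenius endomorphisms
  `ζ_n = ((id, n, 1), id)` of the unit discs (`C.frobEndo`, Ex. 3.3 (ii) "(a) ⇒ (b)");
* `isBaseFrobeniusPair_std` — `(P, F)` IS a base-Frobenius pair: the arrows of `P` are pull-back morphisms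
  (`C0.isPullbackMorphism_iff`: degree `1` and `1 · (unit disc) = (unit disc)|_L`), `P` is a skeleton,
  unit discs are Frobenius-trivial (`isFrobeniusTrivial_of_isIsotropic`), `P → D` is fully faithful and
  essentially surjective; `ζ_n` has degree `n`, identity base, and is of Frobenius type;
* **`ArchFrd.C.isOfPreModelType π : PreFrobenioid.IsOfPreModelType (C.toElem π)`** — no hypothesis on `D`.
The birationally-Frobenius-normalized half of "model type" is piece P1b (separate file).  [FrdI]/[FrdII] §3
are classical; nothing here takes a side on [IUTchIII] Cor. 3.12.
-/

noncomputable section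

namespace Literature.AlgebraicGeometry.Frobenioids

open CategoryTheory Opposite
open scoped Pointwise

namespace ArchFrd

universe v u

variable {D : Type u} [Category.{v} D] (π : D ⥤ D0)

namespace C

/-! ### The standard unit discs: tips, scalars, isotropy -/

/-- The standard object `C.std π d` is naively isotropic (it is a disc). [cite: MochizukiFrdII2008, Ex 3.3 (ii) p.28] -/
theorem std_isNaivelyIsotropic (d : D) : (std π d).fst.IsNaivelyIsotropic :=
  AngularRegion.isIsotropic_isotropicOfTip 1

/-- The standard object is isotropic in the sense of [FrdI] Def. 1.2 (iv) (Ex. 3.3 (ii), first claim).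
[cite: MochizukiFrdII2008, Ex 3.3 (ii) p.28] -/
theorem std_isIsotropic (d : D) : PreFrobenioid.IsIsotropic (C.toElem π) (std π d) :=
  (Ex33ii_isotropic_iff_holds π (std π d)).mpr (std_isNaivelyIsotropic π d)

/-- The Frobenius scalar `t^{1-n}` of a unit disc is `1`. [cite: MochizukiFrdII2008, Ex 3.3 (ii) p.28] -/
theorem frobScalar_std (d : D) (n : ℕ+) : C0.frobScalar (std π d).fst n = 1 := by
  change ofPosReal ℂ (1 : PosReal) * (ofPosReal ℂ (1 : PosReal) ^ (n : ℕ))⁻¹ = 1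
  rw [map_one, one_pow, inv_one, mul_one]

/-- An object EQUAL to a standard object is naively isotropic (transport helper for the presection).
[cite: MochizukiFrdII2008, Ex 3.3 (ii) p.28] -/
theorem isNaivelyIsotropic_of_eq_std {X : C π} {d : D} (h : X = std π d) : X.fst.IsNaivelyIsotropic := by
  rw [h]; exact std_isNaivelyIsotropic π d

/-! ### The presection of standard unit discs over a skeleton of `D` -/

/-- `X` is a standard unit disc over a chosen representative of an isomorphism class of `D`.
[cite: MochizukiFrdI2008, Def. 2.7(i) p.51] -/
def IsStdRep (X : C π) : Prop := ∃ d : D, ModelFrobenioid.IsSkeletonRep d ∧ X = std π d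

/-- The subcategory `P ⊆ C`: standard unit discs over representatives, with the linear arrows of scalar `1`
between them. [cite: MochizukiFrdI2008, Def. 2.7(i) p.51] -/
def stdPresection : Presection (C π) where
  obj X := IsStdRep π X
  hom {X Y} φ := IsStdRep π X ∧ IsStdRep π Y ∧ C0.degFr φ.fst = 1 ∧ C0.scalar φ.fst = 1
  obj_of_hom _ h := ⟨h.1, h.2.1⟩
  hom_id h := ⟨h, h, rfl, rfl⟩
  hom_comp φ ψ hφ hψ := by
    refine ⟨hφ.1, hψ.2.1, ?_, ?_⟩
    · change C0.degFr (φ.fst ≫ ψ.fst) = 1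
      rw [C0.degFr_comp', hφ.2.2.1, hψ.2.2.1, mul_one]
    · change C0.scalar (φ.fst ≫ ψ.fst) = 1
      rw [C0.scalar_comp', hψ.2.2.2, hφ.2.2.2, map_one, one_pow, mul_one]

/-- The lift `C.stdMap π u` of an arrow `u : d₁ → d₂` between representatives lies in `P`.
[cite: MochizukiFrdI2008, Def. 2.7(i) p.51] -/
theorem stdMap_mem {d₁ d₂ : D} (h₁ : ModelFrobenioid.IsSkeletonRep d₁) (h₂ : ModelFrobenioid.IsSkeletonRep d₂)
    (u : d₁ ⟶ d₂) : (stdPresection π).hom (stdMap π u) :=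
  ⟨⟨d₁, h₁, rfl⟩, ⟨d₂, h₂, rfl⟩, rfl, rfl⟩

/-- The base of an arrow of `C` between standard objects is `π` of its `D`-component.
[cite: MochizukiFrdII2008, Ex 3.3 (i) p.28] -/
theorem base_fst_of_std {d₁ d₂ : D} (φ : std π d₁ ⟶ std π d₂) : C0.Base φ.fst = π.map φ.snd := by
  have h := PreFrobenioid.FiberProduct.hom_w φ
  change C0.Base φ.fst ≫ 𝟙 _ = 𝟙 _ ≫ π.map φ.snd at h
  rwa [Category.comp_id, Category.id_comp] at h

/-- An arrow of `P` between standard objects is the standard lift of its `D`-component.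
[cite: MochizukiFrdI2008, Def. 2.7(i) p.51] -/
theorem eq_stdMap_of_mem {d₁ d₂ : D} (φ : std π d₁ ⟶ std π d₂) (hd : C0.degFr φ.fst = 1)
    (hs : C0.scalar φ.fst = 1) : φ = stdMap π φ.snd :=
  CFP.hom_ext (C0.hom_ext (base_fst_of_std π φ) hd hs) rfl

/-! ### The Frobenius endomorphisms of the unit discs -/

/-- Naturality of `ζ_n` along arrows of scalar `1` between unit discs. [cite: MochizukiFrdII2008, Ex 3.3 (ii) p.28] -/
theorem frobEndo_naturality {d₁ d₂ : D} (φ : std π d₁ ⟶ std π d₂) (hs : C0.scalar φ.fst = 1) (n : ℕ+) :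
    φ ≫ frobEndo (std π d₂) (std_isNaivelyIsotropic π d₂) n =
      frobEndo (std π d₁) (std_isNaivelyIsotropic π d₁) n ≫ φ := by
  refine CFP.hom_ext (C0.hom_ext ?_ ?_ ?_) ?_
  · change C0.Base φ.fst ≫ 𝟙 _ = 𝟙 _ ≫ C0.Base φ.fst
    rw [Category.comp_id, Category.id_comp]
  · change C0.degFr φ.fst * n = n * C0.degFr φ.fst
    rw [mul_comm]
  · change (C0.Base φ.fst).act (C0.frobScalar (std π d₂).fst n) * C0.scalar φ.fst ^ (n : ℕ) =
      (C0.Base (C0.frobEndo (std_isNaivelyIsotropic π d₁) n)).act (C0.scalar φ.fst) *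
        C0.frobScalar (std π d₁).fst n ^ (C0.degFr φ.fst : ℕ)
    rw [frobScalar_std, frobScalar_std, hs, map_one, map_one, one_pow, one_pow]
  · change φ.snd ≫ 𝟙 _ = 𝟙 _ ≫ φ.snd
    rw [Category.comp_id, Category.id_comp]

/-- The objects of `P` are naively isotropic. [cite: MochizukiFrdI2008, Def. 2.7(i) p.51] -/
theorem isNaivelyIsotropic_cat (A : (stdPresection π).Cat) : A.1.fst.IsNaivelyIsotropic :=
  isNaivelyIsotropic_of_eq_std π A.2.choose_spec.2

/-- The `P`-Frobenius-section `F : ℕ_{≥1} → End(P ↪ C)`, `n ↦ (ζ_n)`. [cite: MochizukiFrdI2008, Def. 2.7(ii) p.51] -/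
def stdFrobeniusSection : ℕ+ →* End (stdPresection π).ι where
  toFun n :=
    { app := fun A => frobEndo A.1 (isNaivelyIsotropic_cat π A) n
      naturality := fun A B f => by
        obtain ⟨A, dA, hA, rfl⟩ := A
        obtain ⟨B, dB, hB, rfl⟩ := B
        exact frobEndo_naturality π f.1 f.2.2.2.2 n }
  map_one' := by
    apply NatTrans.ext
    funext A
    change frobEndo A.1 (isNaivelyIsotropic_cat π A) 1 = 𝟙 A.1
    exact CFP.hom_ext (C0.frobEndo_one (isNaivelyIsotropic_cat π A)) rfl
  map_mul' m n := by
    apply NatTrans.ext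
    funext A
    change frobEndo A.1 (isNaivelyIsotropic_cat π A) (m * n) =
      frobEndo A.1 (isNaivelyIsotropic_cat π A) n ≫ frobEndo A.1 (isNaivelyIsotropic_cat π A) m
    refine CFP.hom_ext (C0.frobEndo_mul (isNaivelyIsotropic_cat π A) m n) ?_
    change 𝟙 A.1.snd = 𝟙 A.1.snd ≫ 𝟙 A.1.snd
    rw [Category.id_comp]

/-! ### `(P, F)` is a base-Frobenius pair -/

/-- The arrows of `P` are pull-back morphisms of `C`: degree `1`, and `1 · (unit disc) = (unit disc)|_L`.
[cite: MochizukiFrdI2008, Def. 2.7(i) p.51] -/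
theorem isPullbackMorphism_of_mem {X Y : C π} (φ : X ⟶ Y) (h : (stdPresection π).hom φ) :
    PreFrobenioid.IsPullbackMorphism (C.toElem π) φ := by
  obtain ⟨⟨d₁, -, rfl⟩, ⟨d₂, -, rfl⟩, hd, hs⟩ := h
  refine PreFrobenioid.isPullbackMorphism_fiberProduct_of_fst φ ((C0.isPullbackMorphism_iff φ.fst).mpr ⟨hd, ?_⟩)
  rw [hs, one_smul]
  change (AngularRegion.isotropicOfTip (K := ℂ) 1).carrier =
    D0.galAct (D0.Hom.twists (C0.Base φ.fst)) '' (AngularRegion.isotropicOfTip (K := ℂ) 1).carrier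
  rw [C0.image_galAct_of_isIsotropic (AngularRegion.isIsotropic_isotropicOfTip 1)]

/-- `P ↪ C → D` is faithful. [cite: MochizukiFrdI2008, Def. 2.7(i) p.51] -/
theorem stdPresection_toBase_faithful : ((stdPresection π).toBase (C.toElem π)).Faithful := by
  refine ⟨fun {A B} {f g} h => ?_⟩
  obtain ⟨A, dA, hA, rfl⟩ := A
  obtain ⟨B, dB, hB, rfl⟩ := B
  have h' : f.1.snd = g.1.snd := h
  apply Subtype.ext
  rw [eq_stdMap_of_mem π f.1 f.2.2.2.1 f.2.2.2.2, eq_stdMap_of_mem π g.1 g.2.2.2.1 g.2.2.2.2, h']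

/-- `P ↪ C → D` is full: `u` lifts to `((π u, 1, 1), u)`. [cite: MochizukiFrdI2008, Def. 2.7(i) p.51] -/
theorem stdPresection_toBase_full : ((stdPresection π).toBase (C.toElem π)).Full := by
  refine ⟨fun {A B} u => ?_⟩
  obtain ⟨A, dA, hA, rfl⟩ := A
  obtain ⟨B, dB, hB, rfl⟩ := B
  exact ⟨⟨stdMap π u, stdMap_mem π hA hB u⟩, rfl⟩

/-- `P ↪ C → D` is essentially surjective: `d` is isomorphic to its representative, the base of a unit disc.
[cite: MochizukiFrdI2008, Def. 2.7(i) p.51] -/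
theorem stdPresection_toBase_essSurj : ((stdPresection π).toBase (C.toElem π)).EssSurj :=
  ⟨fun d₀ =>
    ⟨⟨std π ((fromSkeleton D).obj (toSkeleton d₀)), _, ModelFrobenioid.isSkeletonRep_obj _, rfl⟩,
      ⟨fromSkeletonToSkeletonIso d₀⟩⟩⟩

/-- `P` is a skeleton: isomorphic unit discs over representatives have isomorphic, hence equal, bases.
[cite: MochizukiFrdI2008, Def. 2.7(i) p.51] -/
theorem stdPresection_isSkeleton : (stdPresection π).IsSkeleton := by
  intro A B ⟨e⟩
  obtain ⟨A, dA, hA, rfl⟩ := A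
  obtain ⟨B, dB, hB, rfl⟩ := B
  have hab : dA = dB :=
    ModelFrobenioid.IsSkeletonRep.eq_of_iso hA hB (((stdPresection π).toBase (C.toElem π)).mapIso e)
  subst hab
  rfl

/-- **The standard unit discs and their Frobenius endomorphisms form a base-Frobenius pair of `C`**
([FrdI] Def. 2.7 (iii)), over an arbitrary base `π : D → D₀`. [cite: MochizukiFrdI2008, Def. 2.7(iii) p.52] -/
theorem isBaseFrobeniusPair_std :
    PreFrobenioid.IsBaseFrobeniusPair (C.toElem π) (stdPresection π) (stdFrobeniusSection π) where
  isBaseSection :=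
    { hom_pullback := fun φ h => isPullbackMorphism_of_mem π φ h
      isSkeleton := stdPresection_isSkeleton π
      isFrobeniusTrivial := fun X hX => by
        obtain ⟨d, -, rfl⟩ := hX
        exact isFrobeniusTrivial_of_isIsotropic π _ (std_isIsotropic π d)
      isEquivalence := by
        haveI := stdPresection_toBase_faithful π
        haveI := stdPresection_toBase_full π
        haveI := stdPresection_toBase_essSurj π
        exact {} }
  isFrobeniusSection :=
    { degFr_eq := fun _ _ => rfl
      isBaseIdentity := fun _ _ => rfl
      isFrobeniusType := fun n A => by
        obtain ⟨A, d, hd, rfl⟩ := A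
        refine ⟨⟨C.isCoAngular_of_isIsotropic π _ (std_isIsotropic π d),
          C0.isIsometry_frobEndo (std_isNaivelyIsotropic π d) n⟩, ?_⟩
        change IsIso (𝟙 d)
        infer_instance }

/-- **The archimedean Frobenioid `C` is of pre-model type** ([FrdI] Def. 2.7 (iii); the pre-model half of
"model type" in [FrdII] Thm. 3.6 (i)), over an arbitrary base `π : D → D₀`.
[cite: MochizukiFrdII2008, Thm 3.6 (i) p.36] -/
theorem isOfPreModelType : PreFrobenioid.IsOfPreModelType (C.toElem π) :=
  ⟨_, _, isBaseFrobeniusPair_std π⟩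

end C

end ArchFrd

end Literature.AlgebraicGeometry.Frobenioids

end
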